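import Summits.RiemannHypothesis.MotivicDoor.AWS.ForcingDown
import Literature.NumberTheory.LFunctions.WeilLogLatticeComb

/-!
# Arithmetic Weil surfaces: separated bumps in a window (AWS sprint, cc-3 gen 6, part 1 of 2)

RH-FREE real-analysis preliminaries for `Theorems.MotivicDoorAWSInfiniteRank` (the lattice of any
carrier of the axiom system `ArithmeticWeilSurface`, `Theorems.MotivicDoorAWSStructure` p195737,
has infinite rank).  No new definitions: everything is stated for an arbitrary finite family
`β : Fin n → ℝ → ℝ` of real functions, resp. an arbitrary `ContDiffBump`, and the bump family is
delivered as one existence statement.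

## Results

* `DisjointFamily.norm_sum_sq`, `DisjointFamily.mul_sum_sq_le_integral_norm_sq`,
  `DisjointFamily.tsupport_sum_subset`: for a finite family `β_j` of real functions with pairwise
  disjoint supports, the real combinations `U_z = Σ_j z_j β_j` satisfy the pointwise Pythagoras
  identity `‖U_z(t)‖² = Σ_j z_j² β_j(t)²`, hence `r Σ_j z_j² ≤ ‖U_z‖₂²` as soon as `∫ β_j² ≥ r`, and
  are supported where the `β_j` are.
* `deriv_sum_mul_apply`, `norm_sum_ofReal_mul_le`: derivative and sup bound of a finite complex
  combination of Weil test functions.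
* `isWeilTest_contDiffBump`, `integrable_contDiffBump_sq`, `two_mul_rIn_le_integral_contDiffBump_sq`,
  `exists_abs_deriv_contDiffBump_le`, `contDiffBump_eq_zero_of_ne_zero`: a `ContDiffBump` is a
  Weil test function with `∫ b² ≥ 2 rIn` and bounded derivative; two bumps whose centres are
  `≥ rOut + rOut'` apart have disjoint supports.
* `exists_disjoint_bumps`: for `0 < a` and every `n` there are `n` Weil test functions
  `β_1, …, β_n` supported in `[-a, a]`, bounded by `1`, with pairwise disjoint supports,
  `∫ β_j² ≥ r > 0` and uniformly bounded derivatives (bumps of radius `a/(4(n+1))` centred at the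
  points `(j+1) a/(n+1)`).

## Honest label

Pure real analysis; nothing here mentions `ζ`, RH, or the existence of an arithmetic Weil surface
(`Nonempty ArithmeticWeilSurface ↔ RH`, p197702, is not touched).
-/

noncomputable section

open Complex Set MeasureTheory Filter Literature.NumberTheory.LFunctions
open scoped BigOperators ComplexConjugate

namespace Summit.RiemannHypothesis.RiemannHypothesis.Theorems.MotivicDoor.AWS

-- the mandated namespace repeats a component (single-conjunct summit)
set_option linter.dupNamespace false

/-! ## §1 Finite real families with pairwise disjoint supports -/

namespace DisjointFamily

variable {n : ℕ} {β : Fin n → ℝ → ℝ}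

/-- Where `β_j(t) ≠ 0` the combination `Σ_k z_k β_k(t)` reduces to its `j`-th term. -/
theorem sum_eq_single_of_ne_zero (hdisj : ∀ j k t, j ≠ k → β j t ≠ 0 → β k t = 0)
    (z : Fin n → ℝ) {t : ℝ} {j : Fin n} (hj : β j t ≠ 0) :
    ∑ k, (z k : ℂ) * ((β k t : ℝ) : ℂ) = (z j : ℂ) * ((β j t : ℝ) : ℂ) :=
  Finset.sum_eq_single j (fun k _ hkj ↦ by rw [hdisj j k t (Ne.symm hkj) hj]; simp)
    (fun h ↦ absurd (Finset.mem_univ j) h)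

/-- Pointwise Pythagoras for disjointly supported families: `‖Σ_j z_j β_j(t)‖² = Σ_j z_j² β_j(t)²`. -/
theorem norm_sum_sq (hdisj : ∀ j k t, j ≠ k → β j t ≠ 0 → β k t = 0) (z : Fin n → ℝ) (t : ℝ) :
    ‖∑ j, (z j : ℂ) * ((β j t : ℝ) : ℂ)‖ ^ 2 = ∑ j, z j ^ 2 * β j t ^ 2 := by
  by_cases h : ∃ j, β j t ≠ 0
  · obtain ⟨j, hj⟩ := h
    rw [sum_eq_single_of_ne_zero hdisj z hj, Finset.sum_eq_single j
      (fun k _ hkj ↦ by rw [hdisj j k t (Ne.symm hkj) hj]; ring)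
      (fun h ↦ absurd (Finset.mem_univ j) h)]
    rw [norm_mul, Complex.norm_real, Complex.norm_real, Real.norm_eq_abs, Real.norm_eq_abs,
      mul_pow, sq_abs, sq_abs]
  · simp only [ne_eq, not_exists, not_not] at h
    simp [h]

/-- A real combination of the family is supported in any closed set containing all `tsupport β_j`. -/
theorem tsupport_sum_subset {K : Set ℝ} (hK : IsClosed K) (hsupp : ∀ j, tsupport (β j) ⊆ K)
    (z : Fin n → ℝ) : tsupport (fun t ↦ ∑ j, (z j : ℂ) * ((β j t : ℝ) : ℂ)) ⊆ K := by
  refine closure_minimal (fun t ht ↦ ?_) hK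
  by_contra hta
  refine ht ?_
  show ∑ j, (z j : ℂ) * ((β j t : ℝ) : ℂ) = 0
  exact Finset.sum_eq_zero fun j _ ↦ by
    rw [image_eq_zero_of_notMem_tsupport fun h ↦ hta (hsupp j h)]; simp

/-- `L²` lower bound on the span: `r Σ_j z_j² ≤ ‖Σ_j z_j β_j‖₂²` when `∫ β_j² ≥ r` for all `j`. -/
theorem mul_sum_sq_le_integral_norm_sq (hdisj : ∀ j k t, j ≠ k → β j t ≠ 0 → β k t = 0)
    (hint : ∀ j, Integrable fun t ↦ β j t ^ 2) {r : ℝ} (hr : ∀ j, r ≤ ∫ t, β j t ^ 2)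
    (z : Fin n → ℝ) : r * ∑ j, z j ^ 2 ≤ ∫ t, ‖∑ j, (z j : ℂ) * ((β j t : ℝ) : ℂ)‖ ^ 2 := by
  simp_rw [norm_sum_sq hdisj z]
  rw [integral_finsetSum _ (fun j _ ↦ (hint j).const_mul (z j ^ 2)), Finset.mul_sum]
  refine Finset.sum_le_sum fun j _ ↦ ?_
  rw [integral_const_mul, mul_comm r]
  exact mul_le_mul_of_nonneg_left (hr j) (sq_nonneg _)

end DisjointFamily

/-! ## §2 Derivatives and sup bounds of finite real combinations -/

/-- `(Σ_j z_j F_j)' = Σ_j z_j F_j'` for Weil test functions `F_j`. -/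
theorem deriv_sum_mul_apply {n : ℕ} {F : Fin n → ℝ → ℂ} (hF : ∀ j, IsWeilTest (F j))
    (z : Fin n → ℂ) (t : ℝ) :
    deriv (fun t ↦ ∑ j, z j * F j t) t = ∑ j, z j * deriv (F j) t := by
  have hd : ∀ j, DifferentiableAt ℝ (F j) t := fun j ↦
    ((hF j).1.differentiable (by simp)).differentiableAt
  have h1 : (fun t ↦ ∑ j, z j * F j t) = ∑ j, (fun t ↦ z j * F j t) := by
    funext t; simp [Finset.sum_apply]
  rw [h1, deriv_sum (fun j _ ↦ (hd j).const_mul (z j))]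
  exact Finset.sum_congr rfl fun j _ ↦ deriv_const_mul (z j) (hd j)

/-- Sup bound for a real combination of real functions with a termwise bound. -/
theorem norm_sum_ofReal_mul_le {n : ℕ} (z : Fin n → ℝ) (f : Fin n → ℝ) {B : ℝ}
    (hf : ∀ j, |f j| ≤ B) : ‖∑ j, (z j : ℂ) * ((f j : ℝ) : ℂ)‖ ≤ (∑ j, |z j|) * B := by
  refine (norm_sum_le _ _).trans ?_
  rw [Finset.sum_mul]
  refine Finset.sum_le_sum fun j _ ↦ ?_
  rw [norm_mul, Complex.norm_real, Complex.norm_real, Real.norm_eq_abs, Real.norm_eq_abs]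
  exact mul_le_mul_of_nonneg_left (hf j) (abs_nonneg _)

/-! ## §3 Smooth bumps as Weil test functions -/

/-- A (complexified) `ContDiffBump` is a Weil test function. -/
theorem isWeilTest_contDiffBump {c : ℝ} (b : ContDiffBump c) :
    IsWeilTest fun t ↦ ((b t : ℝ) : ℂ) :=
  ⟨Complex.ofRealCLM.contDiff.comp b.contDiff, b.hasCompactSupport.comp_left Complex.ofReal_zero⟩

/-- The square of a bump is integrable. -/
theorem integrable_contDiffBump_sq {c : ℝ} (b : ContDiffBump c) : Integrable fun t ↦ b t ^ 2 := by
  have hs : HasCompactSupport fun t ↦ b t ^ 2 :=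
    b.hasCompactSupport.comp_left (g := fun x : ℝ ↦ x ^ 2) (by norm_num)
  exact (b.continuous.pow 2).integrable_of_hasCompactSupport hs

/-- `∫ b² ≥ 2 rIn`: the bump equals `1` on an interval of length `2 rIn`. -/
theorem two_mul_rIn_le_integral_contDiffBump_sq {c : ℝ} (b : ContDiffBump c) :
    2 * b.rIn ≤ ∫ t, b t ^ 2 := by
  have hr := b.rIn_pos
  have hind : (Icc (c - b.rIn) (c + b.rIn)).indicator (fun _ ↦ (1 : ℝ)) ≤ fun t ↦ b t ^ 2 := by
    intro t
    show _ ≤ b t ^ 2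
    by_cases ht : t ∈ Icc (c - b.rIn) (c + b.rIn)
    · rw [indicator_of_mem ht, b.one_of_mem_closedBall (by rw [Real.closedBall_eq_Icc]; exact ht),
        one_pow]
    · rw [indicator_of_notMem ht]; exact sq_nonneg _
  have hIint : Integrable ((Icc (c - b.rIn) (c + b.rIn)).indicator fun _ ↦ (1 : ℝ)) :=
    (continuous_const.integrableOn_Icc).integrable_indicator measurableSet_Icc
  calc 2 * b.rIn = ∫ t, (Icc (c - b.rIn) (c + b.rIn)).indicator (fun _ ↦ (1 : ℝ)) t := by
        rw [integral_indicator_const _ measurableSet_Icc, smul_eq_mul, mul_one, measureReal_def,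
          Real.volume_Icc, ENNReal.toReal_ofReal (by linarith)]
        ring
    _ ≤ ∫ t, b t ^ 2 := integral_mono hIint (integrable_contDiffBump_sq b) hind

/-- The derivative of a bump is bounded. -/
theorem exists_abs_deriv_contDiffBump_le {c : ℝ} (b : ContDiffBump c) :
    ∃ S : ℝ, ∀ t, |deriv b t| ≤ S := by
  have hW := isWeilTest_contDiffBump b
  obtain ⟨S, hS⟩ := hW.deriv.1.continuous.bounded_above_of_compact_support hW.deriv.2
  refine ⟨S, fun t ↦ ?_⟩
  have := hS t
  rw [deriv_ofReal_comp_of_isWeilTest hW] at this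
  simpa [Complex.norm_real] using this

/-- Two bumps whose centres are at least `rOut + rOut'` apart have disjoint supports. -/
theorem contDiffBump_eq_zero_of_ne_zero {c c' : ℝ} (b : ContDiffBump c) (b' : ContDiffBump c')
    (hsep : b.rOut + b'.rOut ≤ |c - c'|) {t : ℝ} (h : b t ≠ 0) : b' t = 0 := by
  by_contra h'
  have ht : t ∈ Metric.ball c b.rOut := by rw [← b.support_eq]; exact h
  have ht' : t ∈ Metric.ball c' b'.rOut := by rw [← b'.support_eq]; exact h'
  rw [Metric.mem_ball, Real.dist_eq] at ht ht'
  have htri : |c - c'| ≤ |c - t| + |t - c'| := abs_sub_le _ _ _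
  rw [abs_sub_comm c t] at htri
  linarith

/-! ## §4 `n` separated bumps in the window `[-a, a]` -/

/-- **Separated bumps.**  For `0 < a` and every `n` there are `n` real Weil test functions
supported in `[-a, a]`, bounded by `1`, with pairwise disjoint supports, `∫ β_j² ≥ r > 0`, and
uniformly bounded derivatives.  (Bumps of outer radius `r = a/(4(n+1))`, inner radius `r/2`,
centred at `(j + 1) a/(n+1)`, `j < n`.) -/
theorem exists_disjoint_bumps {a : ℝ} (ha : 0 < a) (n : ℕ) :
    ∃ (β : Fin n → ℝ → ℝ) (r S : ℝ), 0 < r ∧ 0 ≤ S ∧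
      (∀ j, IsWeilTest fun t ↦ ((β j t : ℝ) : ℂ)) ∧
      (∀ j, tsupport (β j) ⊆ Icc (-a) a) ∧
      (∀ j t, |β j t| ≤ 1) ∧
      (∀ j k t, j ≠ k → β j t ≠ 0 → β k t = 0) ∧
      (∀ j, Integrable fun t ↦ β j t ^ 2) ∧
      (∀ j, r ≤ ∫ t, β j t ^ 2) ∧
      (∀ j t, |deriv (β j) t| ≤ S) := by
  -- the spacing `s = a/(n+1)` and the radius `r = s/4`
  obtain ⟨s, hs0, hs⟩ : ∃ s : ℝ, 0 < s ∧ ((n : ℝ) + 1) * s = a :=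
    ⟨a / (n + 1), by positivity, by field_simp⟩
  obtain ⟨r, hr0, hr⟩ : ∃ r : ℝ, 0 < r ∧ 4 * r = s := ⟨s / 4, by positivity, by ring⟩
  -- the centres `c_j = (j+1) s`
  obtain ⟨c, hc⟩ : ∃ c : Fin n → ℝ, ∀ j, c j = (((j : ℕ) : ℝ) + 1) * s := ⟨_, fun j ↦ rfl⟩
  have hc1 : ∀ j, s ≤ c j := fun j ↦ by
    rw [hc]
    have h0 : (0 : ℝ) ≤ ((j : ℕ) : ℝ) := Nat.cast_nonneg _
    nlinarith
  have hc2 : ∀ j, c j ≤ (n : ℝ) * s := fun j ↦ by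
    rw [hc]
    have h1 : ((j : ℕ) : ℝ) + 1 ≤ n := by exact_mod_cast Nat.succ_le_of_lt j.isLt
    exact mul_le_mul_of_nonneg_right h1 hs0.le
  have hc3 : ∀ j k, j ≠ k → s ≤ |c j - c k| := fun j k hjk ↦ by
    have hne : (j : ℕ) ≠ (k : ℕ) := Fin.val_ne_of_ne hjk
    rw [hc, hc, show (((j : ℕ) : ℝ) + 1) * s - (((k : ℕ) : ℝ) + 1) * s =
      (((j : ℕ) : ℝ) - ((k : ℕ) : ℝ)) * s by ring, abs_mul, abs_of_pos hs0]
    have h1 : (1 : ℝ) ≤ |((j : ℕ) : ℝ) - ((k : ℕ) : ℝ)| := by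
      rcases Nat.lt_or_gt_of_ne hne with h | h
      · have : ((j : ℕ) : ℝ) + 1 ≤ ((k : ℕ) : ℝ) := by exact_mod_cast h
        rw [abs_sub_comm, abs_of_nonneg (by linarith)]; linarith
      · have : ((k : ℕ) : ℝ) + 1 ≤ ((j : ℕ) : ℝ) := by exact_mod_cast h
        rw [abs_of_nonneg (by linarith)]; linarith
    nlinarith
  -- the bumps
  have b : ∀ j : Fin n, {b : ContDiffBump (c j) // b.rIn = r / 2 ∧ b.rOut = r} := fun j ↦
    ⟨⟨r / 2, r, half_pos hr0, half_lt_self hr0⟩, rfl, rfl⟩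
  have hW : ∀ j, IsWeilTest fun t ↦ ((((b j).1 : ℝ → ℝ) t : ℝ) : ℂ) := fun j ↦
    isWeilTest_contDiffBump (b j).1
  choose Sj hSj using fun j ↦ exists_abs_deriv_contDiffBump_le (b j).1
  refine ⟨fun j ↦ ((b j).1 : ℝ → ℝ), r, ∑ j, |Sj j|, hr0, Finset.sum_nonneg fun j _ ↦ abs_nonneg _,
    hW, fun j ↦ ?_, fun j t ↦ ?_, fun j k t hjk hj ↦ ?_, fun j ↦ integrable_contDiffBump_sq (b j).1,
    fun j ↦ ?_, fun j t ↦ ?_⟩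
  · -- support in the window
    rw [(b j).1.tsupport_eq, Real.closedBall_eq_Icc, (b j).2.2]
    have := hc1 j
    have := hc2 j
    exact Icc_subset_Icc (by nlinarith) (by nlinarith)
  · -- bounded by one
    rw [abs_of_nonneg (b j).1.nonneg]
    exact (b j).1.le_one
  · -- pairwise disjoint supports
    refine contDiffBump_eq_zero_of_ne_zero (b j).1 (b k).1 ?_ hj
    rw [(b j).2.2, (b k).2.2]
    have := hc3 j k hjk
    linarith
  · -- `∫ β_j² ≥ r`
    have h := two_mul_rIn_le_integral_contDiffBump_sq (b j).1
    rw [(b j).2.1] at h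
    linarith
  · -- derivative bound
    exact (hSj j t).trans ((le_abs_self _).trans
      (Finset.single_le_sum (fun k _ ↦ abs_nonneg (Sj k)) (Finset.mem_univ j)))

end Summit.RiemannHypothesis.RiemannHypothesis.Theorems.MotivicDoor.AWS
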